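import Mathlib.Analysis.Calculus.Taylor
import Mathlib.Analysis.Calculus.ContDiff.Basic
import Mathlib.Analysis.Calculus.IteratedDeriv.Lemmas
import Literature.Analysis.Calculus.LineRestrictionIteratedDeriv
import Summits.QuantumFields.BalabanUV.Beta.FP.BoxAverageMoments

/-!
# `BalabanUV.Beta.FP.BoxAverageGerm` — road «FP» for binder row D1, N7 PLAN v1 §3, row «N7/GERM-x» of `LEAVES-FP.md`, PART 2 of 2: THE BOX-AVERAGE
# GERM LEMMA — the double unit-box smearing of a `C⁴` function that is HARMONIC at the centre reproduces the point value up to the FOURTH-ORDER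
# remainder: `|∫_{box} ∫_{box} f (z + u − v) du dv − f z| ≤ (sup_{‖x−z‖≤1} ‖D⁴f x‖) / 24`; with the decay `‖D⁴f x‖ ≤ C₄/‖x‖^(6+j)` (the shape of a
# function homogeneous of degree `−2−j`) this is `≤ ((3/2)^(6+j)/24) · C₄ / ‖z‖^(6+j)` for `‖z‖ ≥ 3`
# (β sub-cell; CROSS-LANE supplier seat `b2b-balaban-gan24-formalise-leaf-04` (G-an2-4 formalisation swarm, gen 36) on the road-FP owner's
# invitation «GERM-x LEMMA (Mathlib-only, swarm-ready NOW)», journal l.16935; claim l.16989; part 1 = `FP/BoxAverageMoments`)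

NOT IN PRINT AS SUCH; OUR BOOKKEEPING LEMMA (the mechanism — symmetrisation kills the odd Taylor orders, harmonicity kills the second order because
every coordinate of `u − v` has the same variance and the cross moments vanish, Lagrange remainder for the rest — is textbook real analysis).
HONEST FRAMING (cell charter, verbatim): «discharging `BetaPertH` makes Bałaban's UV stability UNCONDITIONAL — a real constructive-QFT result;
it is NOT the continuum limit and NOT the Clay problem.»  HONEST DEPENDENCY (verbatim): «continuum YM on T⁴ ⇐ BetaPertH ∧ nine spine estimates
(0/9 proved); BetaPertH ⇐ (D1) ∧ (D4) ∧ CAP+tail; G-an2-4 gates asym, D1 and NE2/3/4.»  ABSOLUTE RULE (cell, verbatim): «No internally-minted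
statement may enter as a cited fact. Every hypothesis is either kernel-proved in this package or a verbatim quotation of a PUBLISHED theorem with
page reference.»  Nothing is cited; no `def`; no `def … : Prop`; Mathlib + the tree's [folklore] calculus file
`Literature/Analysis/Calculus/LineRestrictionIteratedDeriv` + part 1 only — NO road input, NO statement about Bałaban's papers.  THIS MODULE
DISCHARGES NOTHING of N7 ∕ `hasym` ∕ D1 by itself: it is the GERM brick of the owner's N7 PLAN v1 §3 («the perfect `Leg` errors are O(‖w‖^{−a−4})»
is the OWNER's consequence, drawn at assembly with HIS box-average representation of the perfect propagator — not asserted here); NOT N7, NOT D1,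
NEVER «G-an2-4 closed», NOT `BetaPertH`, NOT continuum, NOT Clay.

SETTING.  `ι` a finite index type; `ι → ℝ` with Mathlib's SUP norm `‖·‖` (so `‖u − v‖ ≤ 1` for `u, v` in the box) and product Lebesgue measure
`volume`; `box ι := Icc (−½) ½` (volume `1`, part 1); `e_i := Pi.single i 1`; `D²f(z)(e_i, e_i) := iteratedFDeriv ℝ 2 f z (fun _ ↦ e_i)`.  Smoothness
is asked GLOBALLY (`ContDiff ℝ 4 f`) for simplicity of the calculus plumbing; every QUANTITATIVE hypothesis is local (the `1`-neighbourhood of `z`,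
resp. `2 ≤ ‖x‖`) — a kernel singular at the origin is fed through a smooth cutoff equal to `1` off the unit ball (consumer's step with
`ContDiffBump`; a packaged local version may follow as an APPEND).

CONTENT.
* §1 [folklore] `abs_symm_sub_second_le` — one variable: `|g 1 + g (−1) − 2 g 0 − g'' 0| ≤ M/12` for `g ∈ C⁴`, `|g⁽⁴⁾| ≤ M` on `[−1, 1]`
  (`taylor_mean_remainder_lagrange_iteratedDeriv` at `±1`; `taylorWithinEval_three_eq`).
* §2 [folklore] `abs_symm_sub_hessian_le(_of_ball)` — along a segment: `|f (z+w) + f (z−w) − 2 f z − D²f(z)(w,w)| ≤ M ‖w‖⁴/12`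
  (`Literature.Analysis.Calculus.iteratedDeriv_lineRestriction`).
* §5 [our object] **`abs_boxAvg_sub_le`** (abstract form: `C⁴`, `‖D⁴f‖ ≤ M` on the `1`-neighbourhood, harmonic AT `z` ⇒ error `≤ M/24`;
  `integral_prod` + `integral_prod_swap` symmetrisation + part 1's traceless-form lemma + §2) and **`abs_boxAvg_sub_le_of_decay`** (the row's form:
  decay `C₄/‖x‖^(6+j)` and harmonicity for `2 ≤ ‖x‖`, `3 ≤ ‖z‖` ⇒ `≤ ((3/2)^(6+j)/24)·C₄/‖z‖^(6+j)`, EXPLICIT constant).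
Provenance: unit `b2b-balaban-gan24-formalise-leaf-04` (gen 36), 2026-08-20; no existing file touched.  0 sorry.
-/

noncomputable section

open Set MeasureTheory Finset
open Summit.QuantumFields.BalabanUV.Beta.FP.BoxAverageMoments

namespace Summit.QuantumFields.BalabanUV.Beta.FP.BoxAverageGerm

/-! ## §1 One variable: the symmetric fourth-order Taylor bound -/

/-- [folklore] Casting helper for smoothness exponents. -/
theorem natCast_le_four {k : ℕ} (h : k ≤ 4) : (k : WithTop ℕ∞) ≤ 4 := by
  exact_mod_cast h

/-- [folklore] The cubic Taylor polynomial of a `C⁴` function at `0`, evaluated at `x`, with GLOBAL iterated derivatives. -/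
theorem taylorWithinEval_three_eq {g : ℝ → ℝ} (hg : ContDiff ℝ 4 g) {x : ℝ} (hx : x ≠ 0) :
    taylorWithinEval g 3 (uIcc 0 x) 0 x =
      g 0 + iteratedDeriv 1 g 0 * x + iteratedDeriv 2 g 0 * x ^ 2 / 2 + iteratedDeriv 3 g 0 * x ^ 3 / 6 := by
  have hu : UniqueDiffOn ℝ (uIcc 0 x) := by
    rcases lt_or_gt_of_ne hx with h | h
    · rw [uIcc_of_ge h.le]; exact uniqueDiffOn_Icc h
    · rw [uIcc_of_le h.le]; exact uniqueDiffOn_Icc h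
  have hk : ∀ k, k ≤ 4 → iteratedDerivWithin k g (uIcc 0 x) 0 = iteratedDeriv k g 0 := fun k hk =>
    iteratedDerivWithin_eq_iteratedDeriv hu ((hg.of_le (natCast_le_four hk)).contDiffAt) left_mem_uIcc
  rw [taylor_within_apply]
  simp only [sum_range_succ, sum_range_zero, zero_add, sub_zero, hk 0 (by norm_num), hk 1 (by norm_num),
    hk 2 (by norm_num), hk 3 (by norm_num), iteratedDeriv_zero, Nat.factorial, smul_eq_mul]
  push_cast
  ring

/-- [folklore] **SYMMETRIC FOURTH-ORDER TAYLOR BOUND.**  For `g : ℝ → ℝ` of class `C⁴` with `|g⁽⁴⁾| ≤ M` on `[-1, 1]`: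
`|g 1 + g (-1) − 2 g 0 − g'' 0| ≤ M / 12` (the odd orders cancel; Lagrange remainders at `±1`). -/
theorem abs_symm_sub_second_le {g : ℝ → ℝ} (hg : ContDiff ℝ 4 g) {M : ℝ}
    (hM : ∀ t ∈ Icc (-1 : ℝ) 1, |iteratedDeriv 4 g t| ≤ M) :
    |g 1 + g (-1) - 2 * g 0 - iteratedDeriv 2 g 0| ≤ M / 12 := by
  have hcd : ∀ s : Set ℝ, ContDiffOn ℝ (3 + 1) g s := fun s => by exact_mod_cast hg.contDiffOn
  obtain ⟨ξ, hξ, e1⟩ := taylor_mean_remainder_lagrange_iteratedDeriv (n := 3) (x₀ := 0) (x := 1) (by norm_num) (hcd _)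
  obtain ⟨ξ', hξ', e2⟩ := taylor_mean_remainder_lagrange_iteratedDeriv (n := 3) (x₀ := 0) (x := -1) (by norm_num) (hcd _)
  rw [taylorWithinEval_three_eq hg one_ne_zero] at e1
  rw [taylorWithinEval_three_eq hg (by norm_num)] at e2
  have hξm : ξ ∈ Icc (-1 : ℝ) 1 := by
    rw [uIoo_of_le zero_le_one] at hξ; exact ⟨by linarith [hξ.1], hξ.2.le⟩
  have hξ'm : ξ' ∈ Icc (-1 : ℝ) 1 := by
    rw [uIoo_of_ge (by norm_num : (-1 : ℝ) ≤ 0)] at hξ'; exact ⟨hξ'.1.le, by linarith [hξ'.2]⟩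
  have b1 := hM ξ hξm
  have b2 := hM ξ' hξ'm
  have key : g 1 + g (-1) - 2 * g 0 - iteratedDeriv 2 g 0 =
      (iteratedDeriv 4 g ξ + iteratedDeriv 4 g ξ') / 24 := by
    have e1' : g 1 = g 0 + iteratedDeriv 1 g 0 + iteratedDeriv 2 g 0 / 2 + iteratedDeriv 3 g 0 / 6 + iteratedDeriv 4 g ξ / 24 := by
      have := e1; norm_num [Nat.factorial] at this; linarith
    have e2' : g (-1) = g 0 - iteratedDeriv 1 g 0 + iteratedDeriv 2 g 0 / 2 - iteratedDeriv 3 g 0 / 6 + iteratedDeriv 4 g ξ' / 24 := by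
      have := e2; norm_num [Nat.factorial] at this; linarith
    rw [e1', e2']; ring
  rw [key, abs_div, abs_of_pos (by norm_num : (0:ℝ) < 24)]
  have hsum : |iteratedDeriv 4 g ξ + iteratedDeriv 4 g ξ'| ≤ M + M :=
    (abs_add_le _ _).trans (add_le_add b1 b2)
  have h24 : |iteratedDeriv 4 g ξ + iteratedDeriv 4 g ξ'| / 24 ≤ (M + M) / 24 :=
    div_le_div_of_nonneg_right hsum (by norm_num)
  linarith


/-! ## §2 Along a segment: the symmetric second difference against the Hessian form -/

section Segment

variable {E : Type*} [NormedAddCommGroup E] [NormedSpace ℝ E]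

/-- [folklore] **SYMMETRIC SECOND DIFFERENCE VS. THE HESSIAN FORM.**  For `f : E → ℝ` of class `C⁴` and `‖D⁴f‖ ≤ M` on the segment
`[z − w, z + w]`: `|f (z + w) + f (z − w) − 2 f z − D²f(z)(w, w)| ≤ M ‖w‖⁴ / 12` (the line restriction `s ↦ f (z + s • w)` and §1;
`Literature.Analysis.Calculus.iteratedDeriv_lineRestriction`). -/
theorem abs_symm_sub_hessian_le {f : E → ℝ} (hf : ContDiff ℝ 4 f) (z w : E) {M : ℝ}
    (hM : ∀ s ∈ Icc (-1 : ℝ) 1, ‖iteratedFDeriv ℝ 4 f (z + s • w)‖ ≤ M) :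
    |f (z + w) + f (z - w) - 2 * f z - iteratedFDeriv ℝ 2 f z (fun _ => w)| ≤ M * ‖w‖ ^ 4 / 12 := by
  set g : ℝ → ℝ := fun s => f (z + s • w) with hg_def
  have hg : ContDiff ℝ 4 g := Literature.Analysis.Calculus.contDiff_lineRestriction hf z w
  have h2 : iteratedDeriv 2 g 0 = iteratedFDeriv ℝ 2 f z (fun _ => w) := by
    have := Literature.Analysis.Calculus.iteratedDeriv_lineRestriction (n := 2) (hf.of_le (by norm_num)) z w 0
    simpa using this
  have h4 : ∀ t ∈ Icc (-1 : ℝ) 1, |iteratedDeriv 4 g t| ≤ M * ‖w‖ ^ 4 := by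
    intro t ht
    have := Literature.Analysis.Calculus.norm_iteratedDeriv_lineRestriction_le (n := 4) hf z w t
    rw [Real.norm_eq_abs] at this
    exact this.trans (mul_le_mul_of_nonneg_right (hM t ht) (pow_nonneg (norm_nonneg _) _))
  have h := abs_symm_sub_second_le hg h4
  have e1 : g 1 = f (z + w) := by simp [hg_def]
  have e2 : g (-1) = f (z - w) := by simp [hg_def, sub_eq_add_neg]
  have e0 : g 0 = f z := by simp [hg_def]
  rw [e1, e2, e0, h2] at h
  simpa [mul_div_assoc] using h

/-- [folklore] The same with the fourth-derivative bound on the closed `‖w‖`-neighbourhood, `‖w‖ ≤ 1`: if `‖D⁴f x‖ ≤ M` whenever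
`‖x − z‖ ≤ 1`, then `|f (z + w) + f (z − w) − 2 f z − D²f(z)(w, w)| ≤ M / 12`. -/
theorem abs_symm_sub_hessian_le_of_ball {f : E → ℝ} (hf : ContDiff ℝ 4 f) (z : E) {M : ℝ}
    (hM : ∀ x, ‖x - z‖ ≤ 1 → ‖iteratedFDeriv ℝ 4 f x‖ ≤ M) {w : E} (hw : ‖w‖ ≤ 1) :
    |f (z + w) + f (z - w) - 2 * f z - iteratedFDeriv ℝ 2 f z (fun _ => w)| ≤ M / 12 := by
  have hM0 : 0 ≤ M := (norm_nonneg _).trans (hM z (by simp))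
  have hseg : ∀ s ∈ Icc (-1 : ℝ) 1, ‖iteratedFDeriv ℝ 4 f (z + s • w)‖ ≤ M := by
    intro s hs
    refine hM _ ?_
    rw [add_sub_cancel_left, norm_smul, Real.norm_eq_abs]
    calc |s| * ‖w‖ ≤ 1 * 1 := mul_le_mul (abs_le.mpr hs) hw (norm_nonneg _) zero_le_one
      _ = 1 := one_mul 1
  have h := abs_symm_sub_hessian_le hf z w hseg
  have hw4 : ‖w‖ ^ 4 ≤ 1 := pow_le_one₀ (norm_nonneg _) hw
  calc |f (z + w) + f (z - w) - 2 * f z - iteratedFDeriv ℝ 2 f z (fun _ => w)| ≤ M * ‖w‖ ^ 4 / 12 := h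
    _ ≤ M * 1 / 12 := by gcongr
    _ = M / 12 := by ring

end Segment


/-! ## §5 The box-average germ lemma (numbering continues part 1's §3–§4) -/

section Germ

variable {ι : Type*} [Fintype ι] [DecidableEq ι]

/-- **THE BOX-AVERAGE GERM LEMMA (abstract form).**  Let `f : (ι → ℝ) → ℝ` be of class `C⁴`, `z` a point, `‖D⁴f x‖ ≤ M` on the closed
sup-norm `1`-neighbourhood of `z`, and `Σ_i D²f(z)(e_i, e_i) = 0` (HARMONIC AT `z`).  Then the DOUBLE UNIT-BOX AVERAGE of `f` around `z`
is `f z` up to `M / 24`:  `|∫_{u ∈ box} ∫_{v ∈ box} f (z + u − v) − f z| ≤ M / 24`.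
Dictionary: with `□(x) := x + box`, `∫_{□(x)} ∫_{□(y)} f (ξ − η) dξ dη = ∫_{box} ∫_{box} f ((x − y) + u − v) du dv`, so this is the germ of the
box–box smearing `f * 𝟙_box * 𝟙_box` at `z = x − y`.  Mechanism: symmetrise `(u, v) ↦ (v, u)` (kills all odd Taylor orders at once), the
second order averages to `(1/12)·Σ_i D²f(z)(e_i,e_i) = 0` (§4), the rest is the fourth-order Lagrange remainder along segments (§1–§2). [our object] -/
theorem abs_boxAvg_sub_le {f : (ι → ℝ) → ℝ} (hf : ContDiff ℝ 4 f) (z : ι → ℝ) {M : ℝ}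
    (hM : ∀ x, ‖x - z‖ ≤ 1 → ‖iteratedFDeriv ℝ 4 f x‖ ≤ M)
    (hΔ : ∑ i, iteratedFDeriv ℝ 2 f z (fun _ => (Pi.single i (1 : ℝ) : ι → ℝ)) = 0) :
    |(∫ u in box ι, ∫ v in box ι, f (z + u - v)) - f z| ≤ M / 24 := by
  -- the box pair as a probability space
  have hP : ((volume : Measure (ι → ℝ)).restrict (box ι)).prod ((volume : Measure (ι → ℝ)).restrict (box ι))
      = ((volume : Measure (ι → ℝ)).prod volume).restrict (box ι ×ˢ box ι) := Measure.prod_restrict _ _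
  have hSvol : ((volume : Measure (ι → ℝ)).prod volume) (box ι ×ˢ box ι) = 1 := by
    rw [Measure.prod_prod, volume_box, one_mul]
  have hSreal : (((volume : Measure (ι → ℝ)).prod volume).restrict (box ι ×ˢ box ι)).real Set.univ = 1 := by
    rw [measureReal_def, Measure.restrict_apply_univ, hSvol, ENNReal.toReal_one]
  haveI : IsFiniteMeasure (((volume : Measure (ι → ℝ)).prod volume).restrict (box ι ×ˢ box ι)) :=
    ⟨by rw [Measure.restrict_apply_univ, hSvol]; exact ENNReal.one_lt_top⟩
  -- continuity / integrability of the four integrands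
  have hfc : Continuous f := hf.continuous
  have cP : Continuous fun p : (ι → ℝ) × (ι → ℝ) => f (z + (p.1 - p.2)) := by fun_prop
  have cM : Continuous fun p : (ι → ℝ) × (ι → ℝ) => f (z - (p.1 - p.2)) := by fun_prop
  have cQ : Continuous fun p : (ι → ℝ) × (ι → ℝ) => iteratedFDeriv ℝ 2 f z (fun _ => p.1 - p.2) :=
    (iteratedFDeriv ℝ 2 f z).cont.comp (continuous_pi fun _ => continuous_fst.sub continuous_snd)
  have iP := integrableOn_boxProd_of_continuous cP
  have iM := integrableOn_boxProd_of_continuous cM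
  have iQ := integrableOn_boxProd_of_continuous cQ
  have iC : IntegrableOn (fun _ : (ι → ℝ) × (ι → ℝ) => 2 * f z) (box ι ×ˢ box ι) ((volume : Measure (ι → ℝ)).prod volume) :=
    integrableOn_const (by rw [hSvol]; exact ENNReal.one_ne_top)
  -- (1) the iterated integral is the integral over the box pair
  have h1 : (∫ u in box ι, ∫ v in box ι, f (z + u - v))
      = ∫ p in box ι ×ˢ box ι, f (z + (p.1 - p.2)) ∂((volume : Measure (ι → ℝ)).prod volume) := by
    have hint : Integrable (fun p : (ι → ℝ) × (ι → ℝ) => f (z + (p.1 - p.2)))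
        (((volume : Measure (ι → ℝ)).restrict (box ι)).prod ((volume : Measure (ι → ℝ)).restrict (box ι))) := by
      rw [hP]; exact iP
    rw [← hP, integral_prod _ hint]
    refine integral_congr_ae (Filter.Eventually.of_forall fun u => ?_)
    refine integral_congr_ae (Filter.Eventually.of_forall fun v => ?_)
    simp only [add_sub_assoc]
  -- (2) symmetrisation: the reflected integrand has the same integral
  have h2 : ∫ p in box ι ×ˢ box ι, f (z - (p.1 - p.2)) ∂((volume : Measure (ι → ℝ)).prod volume)
      = ∫ p in box ι ×ˢ box ι, f (z + (p.1 - p.2)) ∂((volume : Measure (ι → ℝ)).prod volume) := by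
    rw [← hP, ← integral_prod_swap (fun p : (ι → ℝ) × (ι → ℝ) => f (z + (p.1 - p.2)))]
    refine integral_congr_ae (Filter.Eventually.of_forall fun p => ?_)
    simp only [Prod.fst_swap, Prod.snd_swap]
    congr 1
    abel
  -- (3) the Hessian term averages to zero
  have h3 : ∫ p in box ι ×ˢ box ι, iteratedFDeriv ℝ 2 f z (fun _ => p.1 - p.2) ∂((volume : Measure (ι → ℝ)).prod volume) = 0 := by
    have e : (fun p : (ι → ℝ) × (ι → ℝ) => iteratedFDeriv ℝ 2 f z (fun _ => p.1 - p.2))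
        = fun p => (fderiv ℝ (fderiv ℝ f) z) (p.1 - p.2) (p.1 - p.2) := by
      funext p; rw [iteratedFDeriv_two_apply]
    rw [e]
    refine integral_boxProd_bilin_eq_zero _ ?_
    have e2 : ∀ i : ι, (fderiv ℝ (fderiv ℝ f) z) (Pi.single i 1) (Pi.single i 1)
        = iteratedFDeriv ℝ 2 f z (fun _ => (Pi.single i (1 : ℝ) : ι → ℝ)) := fun i => by
      rw [iteratedFDeriv_two_apply]
    simp_rw [e2]
    exact hΔ
  -- (4) the fourth-order remainder is bounded by M/12 on the box pair
  have h4 : |∫ p in box ι ×ˢ box ι, (f (z + (p.1 - p.2)) + f (z - (p.1 - p.2)) - 2 * f z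
      - iteratedFDeriv ℝ 2 f z (fun _ => p.1 - p.2)) ∂((volume : Measure (ι → ℝ)).prod volume)| ≤ M / 12 := by
    have hbound : ∀ᵐ p ∂(((volume : Measure (ι → ℝ)).prod volume).restrict (box ι ×ˢ box ι)),
        ‖f (z + (p.1 - p.2)) + f (z - (p.1 - p.2)) - 2 * f z - iteratedFDeriv ℝ 2 f z (fun _ => p.1 - p.2)‖ ≤ M / 12 := by
      rw [ae_restrict_iff' (measurableSet_box.prod measurableSet_box)]
      refine Filter.Eventually.of_forall fun p hp => ?_
      rw [Real.norm_eq_abs]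
      exact abs_symm_sub_hessian_le_of_ball hf z hM (norm_sub_le_one_of_mem_box hp.1 hp.2)
    have h := norm_integral_le_of_norm_le_const hbound
    rw [hSreal, mul_one, Real.norm_eq_abs] at h
    exact h
  -- (5) assembly
  have hconst : ∫ _p in box ι ×ˢ box ι, (2 * f z : ℝ) ∂((volume : Measure (ι → ℝ)).prod volume) = 2 * f z := by
    rw [setIntegral_const, measureReal_def, hSvol, ENNReal.toReal_one, one_smul]
  have key : (∫ p in box ι ×ˢ box ι, f (z + (p.1 - p.2)) ∂((volume : Measure (ι → ℝ)).prod volume)) - f z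
      = (1 / 2 : ℝ) * ∫ p in box ι ×ˢ box ι, (f (z + (p.1 - p.2)) + f (z - (p.1 - p.2)) - 2 * f z
          - iteratedFDeriv ℝ 2 f z (fun _ => p.1 - p.2)) ∂((volume : Measure (ι → ℝ)).prod volume) := by
    have iPM : IntegrableOn (fun p : (ι → ℝ) × (ι → ℝ) => f (z + (p.1 - p.2)) + f (z - (p.1 - p.2))) (box ι ×ˢ box ι)
        ((volume : Measure (ι → ℝ)).prod volume) := iP.add iM
    have iA : IntegrableOn (fun p : (ι → ℝ) × (ι → ℝ) => f (z + (p.1 - p.2)) + f (z - (p.1 - p.2)) - 2 * f z) (box ι ×ˢ box ι)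
        ((volume : Measure (ι → ℝ)).prod volume) := iPM.sub iC
    rw [integral_sub iA iQ, integral_sub iPM iC, integral_add iP iM, h2, h3, hconst]
    ring
  rw [h1, key, abs_mul, abs_of_pos (by norm_num : (0 : ℝ) < 1 / 2)]
  linarith [h4]

/-- **THE BOX-AVERAGE GERM LEMMA (decay form, the LEAVES-FP row N7/GERM-x).**  Let `f : (ι → ℝ) → ℝ` be of class `C⁴` with the
FOURTH-DERIVATIVE DECAY `‖D⁴f x‖ ≤ C₄ / ‖x‖^(6+j)` for `2 ≤ ‖x‖` (the shape of a function homogeneous of degree `−2−j` off the origin) and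
HARMONIC off the unit ball, `Σ_i D²f(x)(e_i,e_i) = 0` for `2 ≤ ‖x‖`.  Then for `3 ≤ ‖z‖`:
`|∫_{box} ∫_{box} f (z + u − v) − f z| ≤ ((3/2)^(6+j) / 24) · C₄ / ‖z‖^(6+j)` — EXPLICIT constant, no hidden dependence.
(`‖·‖` is Mathlib's sup norm on `ι → ℝ`; `‖x − z‖ ≤ 1`, `3 ≤ ‖z‖` ⟹ `‖x‖ ≥ ‖z‖ − 1 ≥ (2/3)‖z‖ ≥ 2`.) [our object] -/
theorem abs_boxAvg_sub_le_of_decay {f : (ι → ℝ) → ℝ} (hf : ContDiff ℝ 4 f) {j : ℕ} {C₄ : ℝ} (hC₄ : 0 ≤ C₄)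
    (hD4 : ∀ x : ι → ℝ, 2 ≤ ‖x‖ → ‖iteratedFDeriv ℝ 4 f x‖ ≤ C₄ / ‖x‖ ^ (6 + j))
    (hΔ : ∀ x : ι → ℝ, 2 ≤ ‖x‖ → ∑ i, iteratedFDeriv ℝ 2 f x (fun _ => (Pi.single i (1 : ℝ) : ι → ℝ)) = 0)
    {z : ι → ℝ} (hz : 3 ≤ ‖z‖) :
    |(∫ u in box ι, ∫ v in box ι, f (z + u - v)) - f z| ≤ (3 / 2 : ℝ) ^ (6 + j) / 24 * (C₄ / ‖z‖ ^ (6 + j)) := by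
  have hz0 : 0 < ‖z‖ := by linarith
  have hM : ∀ x : ι → ℝ, ‖x - z‖ ≤ 1 → ‖iteratedFDeriv ℝ 4 f x‖ ≤ (3 / 2 : ℝ) ^ (6 + j) * (C₄ / ‖z‖ ^ (6 + j)) := by
    intro x hx
    have hxz : ‖z‖ - 1 ≤ ‖x‖ := by
      have := norm_sub_norm_le z x
      rw [norm_sub_rev] at hx
      linarith
    have hx2 : 2 ≤ ‖x‖ := by linarith
    have hx23 : (2 / 3 : ℝ) * ‖z‖ ≤ ‖x‖ := by linarith
    have hxpos : 0 < ‖x‖ := by linarith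
    refine (hD4 x hx2).trans ?_
    rw [div_le_iff₀ (pow_pos hxpos _)]
    have hpow : ((2 / 3 : ℝ) * ‖z‖) ^ (6 + j) ≤ ‖x‖ ^ (6 + j) := pow_le_pow_left₀ (by positivity) hx23 _
    have hz' : ‖z‖ ^ (6 + j) ≠ 0 := pow_ne_zero _ hz0.ne'
    have h32 : (3 / 2 : ℝ) ^ (6 + j) * (2 / 3) ^ (6 + j) = 1 := by rw [← mul_pow]; norm_num
    calc C₄ = ((3 / 2 : ℝ) ^ (6 + j) * (2 / 3) ^ (6 + j)) * (C₄ / ‖z‖ ^ (6 + j) * ‖z‖ ^ (6 + j)) := by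
          rw [h32, one_mul, div_mul_cancel₀ _ hz']
      _ = (3 / 2 : ℝ) ^ (6 + j) * (C₄ / ‖z‖ ^ (6 + j)) * ((2 / 3 : ℝ) * ‖z‖) ^ (6 + j) := by
          rw [mul_pow]; ring
      _ ≤ (3 / 2 : ℝ) ^ (6 + j) * (C₄ / ‖z‖ ^ (6 + j)) * ‖x‖ ^ (6 + j) := by
          have hnn : 0 ≤ (3 / 2 : ℝ) ^ (6 + j) * (C₄ / ‖z‖ ^ (6 + j)) := by positivity
          exact mul_le_mul_of_nonneg_left hpow hnn
  have h := abs_boxAvg_sub_le hf z hM (hΔ z (by linarith))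
  calc |(∫ u in box ι, ∫ v in box ι, f (z + u - v)) - f z| ≤ (3 / 2 : ℝ) ^ (6 + j) * (C₄ / ‖z‖ ^ (6 + j)) / 24 := h
    _ = (3 / 2 : ℝ) ^ (6 + j) / 24 * (C₄ / ‖z‖ ^ (6 + j)) := by ring

end Germ

end Summit.QuantumFields.BalabanUV.Beta.FP.BoxAverageGerm

end
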